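import Summits.Ventures.PercRepro.C041TwoExitCount
import Summits.Ventures.PercRepro.C041TriangleCone

/-!
# ROW C-041 — THEOREM (TWO-EXIT BLOCK MAP): the six-vector of a two-exit attachment is the sum over the
colourings of the multigraph of a product of per-exit vectors (p6, gen 31; mine-3's C-041.md §20 (c) BLOCK MAPS
with two exits, §21 (b) the eight colourings of the triangle)

Setting of `C041TwoExitCount`: `glue2 Z₁ u u' Z a Z' a'`, anchor `inl (inl a₁)`, the one-zone classes `cls`.  For
an exit of reached-status `r`, THE EXIT VECTOR `exitVec Z a r` is `Π(Z)` if the exit is reached and `θ_B(Π(Z)) =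
(L₀, L₁, L₂, L₀, L₁, L₂)` if not (`exitVec_of`, `exitVec_of_not`; mine-3's `thB`, `C041TriangleCone`), and its
`θ_R` is `(n, n, n, k_r, k_r, k_r)` — the admissible count and, if reached, the invalid count (`thR_exitVec`).  The
CONTRIBUTION of one colouring (`contrib`, by the statuses — with `x = exitOf w rd`, `x' = exitOf w' rd'`: `x * x'`
(both merged), `x * θ_R x'` / `θ_R x * x'` (one merged), `θ_R (x * x')` (both separated in one sub-zone),
`θ_R x * θ_R x'` (both separated apart)), the FIBRE VECTOR over a colouring `ω` of `Z₁` (`fibVec`), and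

* the six-vector of the attachment is the sum of the fibre vectors (`sixVec_eq_sum_fibVec`).

The identification `fibVec ω = contrib (statuses of ω)` (`fibVec_eq`) and THEOREM (TWO-EXIT BLOCK MAP)
`sixVec_glue2` are in `C041TwoExitMain`; the triangle `a₁ – u – u' – a₁` (eight colourings) gives mine-3's
`thetaTri` in `C041TriangleDict`.
-/

namespace PercRepro

namespace ZoneZ

namespace TwoExit

open ZoneData TreeClosure Finset

/-! ## The exit vector of one zone -/

section OneZone

variable {V E T₁ T₂ : Type} (Z : ZoneData V E T₁ T₂) (a : V) [Fintype E] [DecidableEq E] [Fintype T₁]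
  [DecidableEq T₁] [Fintype T₂] [DecidableEq T₂] (r : Prop)

/-- The six one-zone classes of an exit: `(F, F+T₁, F+T₂, I_F, I_F+I₁, I_F+I₂)` with the invalid counts
replaced by the plain ones when the exit is not reached. -/
noncomputable def exitVec : Vec6 :=
  ![(#(cls Z a true true false r) : ℝ), #(cls Z a false true false r), #(cls Z a true false false r),
    #(cls Z a true true true r), #(cls Z a false true true r), #(cls Z a true false true r)]

/-- The admissible count and the (reached-)invalid count, three times each. -/
noncomputable def nVec : Vec6 :=
  ![(#(cls Z a false false false r) : ℝ), #(cls Z a false false false r), #(cls Z a false false false r),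
    #(cls Z a false false true r), #(cls Z a false false true r), #(cls Z a false false true r)]

/-- The class `(T, T, F)` is `F`. -/
theorem cls_TTF : cls Z a true true false r = Z.Fset a := by
  ext τ
  rw [mem_cls, mem_Fset]
  simp only [true_implies, Bool.false_eq_true, false_implies, and_true]

/-- The class `(F, T, F)` is `F + T₁`. -/
theorem cls_FTF : cls Z a false true false r = Z.FAset a := by
  ext τ
  rw [mem_cls, mem_FAset]
  simp only [true_implies, Bool.false_eq_true, false_implies, and_true, true_and]

/-- The class `(T, F, F)` is `F + T₂`. -/
theorem cls_TFF : cls Z a true false false r = Z.FBset a := by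
  ext τ
  rw [mem_cls, mem_FBset]
  simp only [true_implies, Bool.false_eq_true, false_implies, and_true]

/-- The class `(F, F, F)` is the admissible states. -/
theorem cls_FFF : cls Z a false false false r = Z.Aset (∅ : Set V) := by
  ext τ
  rw [mem_cls, mem_Aset_empty]
  simp only [Bool.false_eq_true, false_implies, and_true]

/-- The class `(T, T, T)` of a reached exit is `I_F`. -/
theorem cls_TTT_of (hr : r) : cls Z a true true true r = Z.IFset a := by
  ext τ
  rw [mem_cls, mem_IFset]
  simp only [true_implies, hr]
  tauto

/-- The class `(T, T, T)` of an unreached exit is `F`. -/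
theorem cls_TTT_of_not (hr : ¬ r) : cls Z a true true true r = Z.Fset a := by
  ext τ
  rw [mem_cls, mem_Fset]
  simp only [true_implies, hr, false_implies, and_true]

/-- The class `(F, T, T)` of a reached exit is `I_F + I₁`. -/
theorem cls_FTT_of (hr : r) : cls Z a false true true r = Z.IAset a := by
  ext τ
  rw [mem_cls, mem_IAset]
  simp only [true_implies, Bool.false_eq_true, false_implies, true_and, hr]
  tauto

/-- The class `(F, T, T)` of an unreached exit is `F + T₁`. -/
theorem cls_FTT_of_not (hr : ¬ r) : cls Z a false true true r = Z.FAset a := by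
  ext τ
  rw [mem_cls, mem_FAset]
  simp only [true_implies, Bool.false_eq_true, false_implies, true_and, hr, and_true]

/-- The class `(T, F, T)` of a reached exit is `I_F + I₂`. -/
theorem cls_TFT_of (hr : r) : cls Z a true false true r = Z.IBset a := by
  ext τ
  rw [mem_cls, mem_IBset]
  simp only [true_implies, Bool.false_eq_true, false_implies, true_and, hr]
  tauto

/-- The class `(T, F, T)` of an unreached exit is `F + T₂`. -/
theorem cls_TFT_of_not (hr : ¬ r) : cls Z a true false true r = Z.FBset a := by
  ext τ
  rw [mem_cls, mem_FBset]
  simp only [true_implies, Bool.false_eq_true, false_implies, hr, and_true]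

/-- The class `(F, F, T)` of a reached exit is the invalid states. -/
theorem cls_FFT_of (hr : r) : cls Z a false false true r = Z.Iset a := by
  ext τ
  rw [mem_cls, mem_Iset]
  simp only [true_implies, Bool.false_eq_true, false_implies, true_and, hr]

/-- The class `(F, F, T)` of an unreached exit is the admissible states. -/
theorem cls_FFT_of_not (hr : ¬ r) : cls Z a false false true r = Z.Aset (∅ : Set V) := by
  ext τ
  rw [mem_cls, mem_Aset_empty]
  simp only [true_implies, Bool.false_eq_true, false_implies, hr, and_true]

/-- **The exit vector of a reached exit is the six-vector.** -/
theorem exitVec_of (hr : r) : exitVec Z a r = Z.sixVec a := by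
  funext i
  fin_cases i <;>
    simp [exitVec, sixVec, cls_TTF, cls_FTF, cls_TFF, cls_TTT_of Z a r hr, cls_FTT_of Z a r hr,
      cls_TFT_of Z a r hr]

/-- **The exit vector of an unreached exit is `θ_B` of the six-vector.** -/
theorem exitVec_of_not (hr : ¬ r) : exitVec Z a r = thB (Z.sixVec a) := by
  funext i
  fin_cases i <;>
    simp [exitVec, sixVec, thB, cls_TTF, cls_FTF, cls_TFF, cls_TTT_of_not Z a r hr, cls_FTT_of_not Z a r hr,
      cls_TFT_of_not Z a r hr]

/-- `n = (F + T₁) + (F + T₂) − F` is the admissible count. -/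
theorem card_FAset_add_card_FBset : #(Z.FAset a) + #(Z.FBset a) = #(Z.Aset (∅ : Set V)) + #(Z.Fset a) := by
  rw [Z.card_FAset a, Z.card_FBset a, Z.card_Aset_eq_count a]
  ring

/-- **`θ_R` of the exit vector** is the admissible count and the reached-invalid count. -/
theorem thR_exitVec : thR (exitVec Z a r) = nVec Z a r := by
  have h1 : (#(Z.FAset a) : ℝ) + #(Z.FBset a) - #(Z.Fset a) = #(Z.Aset (∅ : Set V)) := by
    have := card_FAset_add_card_FBset Z a
    have h' : ((#(Z.FAset a) + #(Z.FBset a) : ℕ) : ℝ) = ((#(Z.Aset (∅ : Set V)) + #(Z.Fset a) : ℕ) : ℝ) := by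
      rw [this]
    push_cast at h'
    linarith
  have h2 : (#(Z.IAset a) : ℝ) + #(Z.IBset a) - #(Z.IFset a) = #(Z.Iset a) := by
    have := Z.card_Iset_add_IFset a
    have h' : ((#(Z.Iset a) + #(Z.IFset a) : ℕ) : ℝ) = ((#(Z.IAset a) + #(Z.IBset a) : ℕ) : ℝ) := by
      rw [this]
    push_cast at h'
    linarith
  by_cases hr : r
  · funext i
    fin_cases i <;>
      simp [exitVec, nVec, thR, nAdm, kInv, cls_TTF, cls_FTF, cls_TFF, cls_FFF, cls_TTT_of Z a r hr,
        cls_FTT_of Z a r hr, cls_TFT_of Z a r hr, cls_FFT_of Z a r hr, h1, h2]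
  · funext i
    fin_cases i <;>
      simp [exitVec, nVec, thR, nAdm, kInv, cls_TTF, cls_FTF, cls_TFF, cls_FFF, cls_TTT_of_not Z a r hr,
        cls_FTT_of_not Z a r hr, cls_TFT_of_not Z a r hr, cls_FFT_of_not Z a r hr, h1]

end OneZone

/-! ## The contribution of one colouring -/

open Classical in
/-- The per-exit vector of a six-vector `w` for reached-status `r`: `w` if reached, `θ_B w` if not. -/
noncomputable def exitOf (w : Vec6) (r : Prop) : Vec6 := if r then w else thB w

open Classical in
/-- **The contribution of one colouring** of the multigraph to the six-vector of a two-exit attachment, by the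
statuses of the exits (`mg` / `mg'` merged, `rd` / `rd'` reached, `bc` blue-connected): with `x = exitOf w rd`,
`x' = exitOf w' rd'` — `x * x'` if both are merged, `x * θ_R x'` / `θ_R x * x'` if one is, `θ_R (x * x')` if
both are separated in one sub-zone, `θ_R x * θ_R x'` if in two. -/
noncomputable def contrib (w w' : Vec6) (mg rd mg' rd' bc : Prop) : Vec6 :=
  if mg then (if mg' then exitOf w rd * exitOf w' rd' else exitOf w rd * thR (exitOf w' rd'))
  else (if mg' then thR (exitOf w rd) * exitOf w' rd'
    else (if bc then thR (exitOf w rd * exitOf w' rd') else thR (exitOf w rd) * thR (exitOf w' rd')))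

/-- `exitOf` of the six-vector is the exit vector. -/
theorem exitOf_sixVec {V E T₁ T₂ : Type} (Z : ZoneData V E T₁ T₂) (a : V) [Fintype E] [DecidableEq E]
    [Fintype T₁] [DecidableEq T₁] [Fintype T₂] [DecidableEq T₂] (r : Prop) :
    exitOf (Z.sixVec a) r = exitVec Z a r := by
  unfold exitOf
  by_cases hr : r
  · rw [if_pos hr, exitVec_of Z a r hr]
  · rw [if_neg hr, exitVec_of_not Z a r hr]

/-- Two six-vectors agreeing in every coordinate are equal (the coordinates as numerals). -/
theorem vec6_ext (f g : Vec6) (h0 : f 0 = g 0) (h1 : f 1 = g 1) (h2 : f 2 = g 2) (h3 : f 3 = g 3)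
    (h4 : f 4 = g 4) (h5 : f 5 = g 5) : f = g := by
  funext i
  fin_cases i
  · exact h0
  · exact h1
  · exact h2
  · exact h3
  · exact h4
  · exact h5

/-! ## The fibre vector and THEOREM (TWO-EXIT BLOCK MAP) -/

variable {V₁ E₁ U₁ U₂ V E T₁ T₂ V' E' T₁' T₂' : Type}
variable (Z₁ : ZoneData V₁ E₁ U₁ U₂) (u u' : V₁) (Z : ZoneData V E T₁ T₂) (a : V) (Z' : ZoneData V' E' T₁' T₂')
  (a' : V') (a₁ : V₁)
variable [Fintype E₁] [DecidableEq E₁] [Fintype E] [DecidableEq E] [Fintype T₁] [DecidableEq T₁]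
  [Fintype T₂] [DecidableEq T₂] [Fintype E'] [DecidableEq E'] [Fintype T₁'] [DecidableEq T₁']
  [Fintype T₂'] [DecidableEq T₂']

/-- The six fibre counts over a colouring `ω` of `Z₁`. -/
noncomputable def fibVec (ω : E₁ → Bool) : Vec6 :=
  ![(#(fib Z₁ u u' Z a Z' a' a₁ ω true true false) : ℝ), #(fib Z₁ u u' Z a Z' a' a₁ ω false true false),
    #(fib Z₁ u u' Z a Z' a' a₁ ω true false false), #(fib Z₁ u u' Z a Z' a' a₁ ω true true true),
    #(fib Z₁ u u' Z a Z' a' a₁ ω false true true), #(fib Z₁ u u' Z a Z' a' a₁ ω true false true)]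

omit [Fintype E₁] [DecidableEq E₁] in
/-- A fibre is the filter of its condition on pairs (with any decidability instance). -/
theorem fib_eq_filter (ω : E₁ → Bool) (c1 c2 k : Bool)
    [DecidablePred fun p : State E' T₁' T₂' × State E T₁ T₂ => fibCond Z₁ u u' Z a Z' a' a₁ ω c1 c2 k p.1 p.2] :
    fib Z₁ u u' Z a Z' a' a₁ ω c1 c2 k =
      univ.filter fun p : State E' T₁' T₂' × State E T₁ T₂ => fibCond Z₁ u u' Z a Z' a' a₁ ω c1 c2 k p.1 p.2 := by
  ext p
  rw [mem_fib, Finset.mem_filter]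
  exact (and_iff_right (Finset.mem_univ _)).symm

/-- One count of the attachment, as the sum over the colourings of the fibre counts. -/
theorem card_eq_sum_card_fib (S : Finset (State ((E₁ ⊕ E') ⊕ E) (T₁' ⊕ T₁) (T₂' ⊕ T₂))) (c1 c2 k : Bool)
    (h : ∀ σ, σ ∈ S ↔ fibCond Z₁ u u' Z a Z' a' a₁ (col₁ σ) c1 c2 k (st' σ) (st σ)) :
    #S = ∑ ω : E₁ → Bool, #(fib Z₁ u u' Z a Z' a' a₁ ω c1 c2 k) := by
  classical
  have e : S = univ.filter fun σ => fibCond Z₁ u u' Z a Z' a' a₁ (col₁ σ) c1 c2 k (st' σ) (st σ) := by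
    ext σ
    rw [h, Finset.mem_filter]
    exact (and_iff_right (Finset.mem_univ _)).symm
  rw [e, card_filter_eq _ (fun p : (E₁ → Bool) × State E' T₁' T₂' × State E T₁ T₂ =>
    fibCond Z₁ u u' Z a Z' a' a₁ p.1 c1 c2 k p.2.1 p.2.2) (fun _ => Iff.rfl), card_filter_prod_eq_sum]
  refine Finset.sum_congr rfl fun ω _ => ?_
  rw [fib_eq_filter]

/-- **The six-vector of the attachment is the sum of the fibre vectors.** -/
theorem sixVec_eq_sum_fibVec :
    (glue2 Z₁ u u' Z a Z' a').sixVec (Sum.inl (Sum.inl a₁)) = ∑ ω : E₁ → Bool, fibVec Z₁ u u' Z a Z' a' a₁ ω := by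
  refine vec6_ext _ _ ?_ ?_ ?_ ?_ ?_ ?_
  · rw [Finset.sum_apply, sixVec_zero,
      card_eq_sum_card_fib Z₁ u u' Z a Z' a' a₁ _ true true false (mem_Fset_iff Z₁ u u' Z a Z' a' a₁)]
    push_cast
    simp only [fibVec, Matrix.cons_val]
  · rw [Finset.sum_apply, sixVec_one,
      card_eq_sum_card_fib Z₁ u u' Z a Z' a' a₁ _ false true false (mem_FAset_iff Z₁ u u' Z a Z' a' a₁)]
    push_cast
    simp only [fibVec, Matrix.cons_val]
  · rw [Finset.sum_apply, sixVec_two,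
      card_eq_sum_card_fib Z₁ u u' Z a Z' a' a₁ _ true false false (mem_FBset_iff Z₁ u u' Z a Z' a' a₁)]
    push_cast
    simp only [fibVec, Matrix.cons_val]
  · rw [Finset.sum_apply, sixVec_three,
      card_eq_sum_card_fib Z₁ u u' Z a Z' a' a₁ _ true true true (mem_IFset_iff Z₁ u u' Z a Z' a' a₁)]
    push_cast
    simp only [fibVec, Matrix.cons_val]
  · rw [Finset.sum_apply, sixVec_four,
      card_eq_sum_card_fib Z₁ u u' Z a Z' a' a₁ _ false true true (mem_IAset_iff Z₁ u u' Z a Z' a' a₁)]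
    push_cast
    simp only [fibVec, Matrix.cons_val]
  · rw [Finset.sum_apply, sixVec_five,
      card_eq_sum_card_fib Z₁ u u' Z a Z' a' a₁ _ true false true (mem_IBset_iff Z₁ u u' Z a Z' a' a₁)]
    push_cast
    simp only [fibVec, Matrix.cons_val]

end TwoExit

end ZoneZ

end PercRepro
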